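import Summits.QuantumFields.YangMills.Theorems.InfiniteVolumeContinuumWeightedWhitneyLevelWeights
import Summits.QuantumFields.YangMills.Theorems.InfiniteVolumeContinuumTemperedCurrenciesDefs
import Summits.QuantumFields.YangMills.Theorems.AtomicCalibrationRWhitneyAssembly
import Summits.QuantumFields.YangMills.Theorems.AtomicCalibrationRGevreyMollifier

/-!
# Leaf `HypercubicOSDataFromInfiniteVolume` (stmt-QuantumFields-19868), LINES «TemperedPeak» / «OctaveDoubling» — the registered stub W
# `stub_weightedWhitneyPkg : WhitneyPkgW` BY NAME (the WEIGHTED off-diagonal Whitney package)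

`WhitneyPkgW` (Defs module `…InfiniteVolumeContinuumTemperedCurrenciesDefs`, currency of both g19 lines of planner ym-idea-11, critic idea-crit-9 #97/#98) is
the landed E2 package `WhitneyPkg` (`AtomicCalibrationR.MirrorCalibration.stub_offDiagonalWhitney`) with ONE more pair of clauses: for the prescribed exponent
`K₀`, `Σ_j M_j · ρ_j^{−K₀ n}` is summable with the same admissible bound `α Cⁿ (n!)^γ ‖F‖_{N n}` (atoms near the coincidence locus have small radius
`ρ_j`, so the weight costs extra flatness of `F` there).  Assembly exactly as `AtomicCalibrationR.WhitneyAssembly` (construction (T): telescoping pairwise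
cut-offs × product grid bumps, dyadic levels, two colours glued over `(ℕ × cubes) ⊕ (ℕ × cubes)` and enumerated by `ℕ`), fed by the weighted level
estimate `WeightedWhitney.level_weights_weighted` (flatness order `K = N'n + 4n + 2 + K₀ n` at the band levels; Schwartz index `N = N' + 6 + K₀`):

* `colour_package_weighted` — one colour: clauses (ii)–(vii) of `WhitneyPkgW` over `ℕ × (Fin n × Fin 4 → ℤ)`, total mass and WEIGHTED total
  mass `2BS`;
* `whitneyPkgW_of_gevrey` — `WhitneyPkgW` from a Gevrey profile and a Gevrey bound on `PairCutoff.stepψ`;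
* `stub_weightedWhitneyPkg` — the registered stub BY NAME, from `GevreyMollifier.exists_gevrey_periodic_partition` and `WhitneyAssembly.stepψ_gevrey`.

HONEST LABEL: closes the pure-analysis side stub W of two DRAFT lines on the R2a-IV leaf 19868 only (its consumer E3T `stub_temperedMomentBoundA` and
the load-bearing D1/D2/CAL/N of those lines stay OPEN); no crux, rung, leaf or summit; nothing here touches Yang–Mills; the YM mass gap is NOT proved.
[folklore]
-/

set_option autoImplicit false

noncomputable section

open scoped BigOperators ContDiff
open Set Filter
open Summit.QuantumFields.YangMills.Cruxes.AtomicCalibrationR.PairCutoff (pairCut stepψ)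
open Summit.QuantumFields.YangMills.Cruxes.AtomicCalibrationR.GridPartition (gridBump gridCentre)
open Summit.QuantumFields.YangMills.Cruxes.AtomicCalibrationR.TelescopingAssembly (tele)
open Summit.QuantumFields.YangMills.Cruxes.AtomicCalibrationR.WhitneyPieces (contDiff_piece hasCompactSupport_piece
  tsupport_piece_subset piece_eq_zero_of_not_alive exists_coord_sep_of_alive exists_coord_sep_dummy hasSum_pieces)
open Summit.QuantumFields.YangMills.Cruxes.AtomicCalibrationR.LevelConstants (mesh_pos two_mesh_le_half)
open Summit.QuantumFields.YangMills.Cruxes.AtomicCalibrationR.RealImag (contDiff_re_comp contDiff_im_comp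
  norm_iteratedFDeriv_re_comp_le norm_iteratedFDeriv_im_comp_le re_add_I_mul_im)
open Summit.QuantumFields.YangMills.Cruxes.AtomicCalibrationR.WhitneyAssembly (stepψ_gevrey)
open Summit.QuantumFields.YangMills.Cruxes.AtomicCalibrationR (GevreyMollifier.exists_gevrey_periodic_partition)
open Summit.QuantumFields.YangMills.Cruxes.HypercubicOSDataFromInfiniteVolume.WeightedWhitney (level_weights_weighted)
open Literature.MathematicalPhysics.QuantumLattice (schwartzNorm schwartzNorm_nonneg)
open Literature.MathematicalPhysics.AQFT (IsOffDiagonal coincidenceLocus)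

namespace Summit.QuantumFields.YangMills.Cruxes.HypercubicOSDataFromInfiniteVolume.WeightedWhitney

variable {n : ℕ}

/-- **One colour of the weighted package.**  As `WhitneyAssembly.colour_package`, with the extra per-level hypothesis
`Σ' c, M k c / ρ_k^{K₀ n} ≤ B·2^{−k}·S` and the two extra conclusions (summability and total `2BS` of the weighted masses). [folklore] -/
theorem colour_package_weighted {Λ : ℝ} (hΛ : 1 ≤ Λ) (N' K₀ : ℕ) {φ : ℝ → ℝ} (hφ : ContDiff ℝ ∞ φ) (hφs : tsupport φ ⊆ Icc (-1 : ℝ) 1)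
    (hφ1 : ∀ t, ∑' c : ℤ, φ (t - c) = 1) {G : (Fin n → EuclideanSpace ℝ (Fin 4)) → ℝ} (hG : ContDiff ℝ ∞ G)
    (hGloc : ∀ z : Fin n → EuclideanSpace ℝ (Fin 4), (∃ l l' : Fin n, l ≠ l' ∧ z l = z l') → G z = 0) (κ₀ : ℂ)
    {B S : ℝ} (M : ℕ → (Fin n × Fin 4 → ℤ) → ℝ) (hM0 : ∀ k c, 0 ≤ M k c) (hMs : ∀ k, Summable (M k))
    (hMle : ∀ k, ∑' c, M k c ≤ B * (2 : ℝ)⁻¹ ^ k * S)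
    (hMle' : ∀ k, ∑' c, M k c / (2 * ((2 : ℝ)⁻¹ ^ k / (8 * (Λ + 1)))) ^ (K₀ * n) ≤ B * (2 : ℝ)⁻¹ ^ k * S)
    (hMv : ∀ (k : ℕ) (c : Fin n × Fin 4 → ℤ) (m : ℕ), m ≤ N' * n → ∀ z : Fin n → EuclideanSpace ℝ (Fin 4),
      ‖iteratedFDeriv ℝ m (fun w => G w * (tele (fun j => pairCut n j w) k *
        gridBump φ n ((2 : ℝ)⁻¹ ^ k / (8 * (Λ + 1))) c w)) z‖ ≤ M k c / (2 * ((2 : ℝ)⁻¹ ^ k / (8 * (Λ + 1)))) ^ m) :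
    ∃ (Gp : ℕ × (Fin n × Fin 4 → ℤ) → SchwartzMap (Fin n → EuclideanSpace ℝ (Fin 4)) ℝ)
      (cp : ℕ × (Fin n × Fin 4 → ℤ) → Fin n → EuclideanSpace ℝ (Fin 4)) (ρ Mw : ℕ × (Fin n × Fin 4 → ℤ) → ℝ),
      (∀ p, 0 < ρ p ∧ ρ p ≤ 1 / 2) ∧
      (∀ p, tsupport (Gp p) ⊆ {z | ∀ l, ‖z l - cp p l‖ ≤ ρ p}) ∧
      (∀ p (l l' : Fin n), l ≠ l' → ∃ i : Fin 4, Λ * ρ p ≤ |cp p l i - cp p l' i|) ∧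
      (∀ p (m : ℕ), m ≤ N' * n → ∀ z, ‖iteratedFDeriv ℝ m (Gp p) z‖ ≤ Mw p / ρ p ^ m) ∧
      (∀ p, 0 ≤ Mw p) ∧ Summable Mw ∧ ∑' p, Mw p ≤ 2 * B * S ∧
      Summable (fun p => Mw p / ρ p ^ (K₀ * n)) ∧ ∑' p, Mw p / ρ p ^ (K₀ * n) ≤ 2 * B * S ∧
      ∀ z, HasSum (fun p => κ₀ * ((Gp p z : ℝ) : ℂ)) (κ₀ * ((G z : ℝ) : ℂ)) := by
  classical
  have hΛ0 : 0 < Λ := by linarith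
  have hρpos : ∀ k : ℕ, 0 < (2 * ((2 : ℝ)⁻¹ ^ k / (8 * (Λ + 1)))) ^ (K₀ * n) := fun k =>
    pow_pos (mul_pos two_pos (mesh_pos hΛ k)) _
  have hM0' : ∀ k c, 0 ≤ M k c / (2 * ((2 : ℝ)⁻¹ ^ k / (8 * (Λ + 1)))) ^ (K₀ * n) := fun k c =>
    div_nonneg (hM0 k c) (hρpos k).le
  have hMs' : ∀ k, Summable (fun c => M k c / (2 * ((2 : ℝ)⁻¹ ^ k / (8 * (Λ + 1)))) ^ (K₀ * n)) := fun k =>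
    (hMs k).div_const _
  have hgeo : Summable (fun k : ℕ => B * (2 : ℝ)⁻¹ ^ k * S) :=
    ((summable_geometric_of_lt_one (by norm_num) (by norm_num)).mul_left B).mul_right S
  -- the pieces as Schwartz maps, the centres, the radii, the weights
  refine ⟨fun p => (hasCompactSupport_piece G hφs p.1 (mesh_pos hΛ p.1) p.2).toSchwartzMap
      (contDiff_piece hG hφ p.1 ((2 : ℝ)⁻¹ ^ p.1 / (8 * (Λ + 1))) p.2),
    fun p => if (∃ z, tele (fun j => pairCut n j z) p.1 * gridBump φ n ((2 : ℝ)⁻¹ ^ p.1 / (8 * (Λ + 1))) p.2 z ≠ 0)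
      then gridCentre n ((2 : ℝ)⁻¹ ^ p.1 / (8 * (Λ + 1))) p.2
      else gridCentre n (2 * Λ * (2 * ((2 : ℝ)⁻¹ ^ p.1 / (8 * (Λ + 1))))) (fun q => ((q.1 : ℕ) : ℤ)),
    fun p => 2 * ((2 : ℝ)⁻¹ ^ p.1 / (8 * (Λ + 1))), fun p => M p.1 p.2, ?_, ?_, ?_, ?_, fun p => hM0 p.1 p.2, ?_, ?_, ?_, ?_, ?_⟩
  · -- (ii) radii
    intro p
    dsimp only
    exact ⟨mul_pos two_pos (mesh_pos hΛ p.1), two_mesh_le_half hΛ p.1⟩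
  · -- (iii) support
    intro p
    dsimp only
    by_cases halive : ∃ z, tele (fun j => pairCut n j z) p.1 * gridBump φ n ((2 : ℝ)⁻¹ ^ p.1 / (8 * (Λ + 1))) p.2 z ≠ 0
    · rw [if_pos halive]
      exact tsupport_piece_subset G hφs p.1 (mesh_pos hΛ p.1) p.2
    · rw [if_neg halive]
      intro z hz
      exfalso
      have h0 := piece_eq_zero_of_not_alive G φ p.1 ((2 : ℝ)⁻¹ ^ p.1 / (8 * (Λ + 1))) p.2 halive
      have hempty : tsupport (fun w : Fin n → EuclideanSpace ℝ (Fin 4) => G w * (tele (fun j => pairCut n j w) p.1 *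
          gridBump φ n ((2 : ℝ)⁻¹ ^ p.1 / (8 * (Λ + 1))) p.2 w)) = ∅ := by
        rw [h0]; exact tsupport_eq_empty_iff.2 rfl
      change z ∈ tsupport (fun w : Fin n → EuclideanSpace ℝ (Fin 4) => G w * (tele (fun j => pairCut n j w) p.1 *
          gridBump φ n ((2 : ℝ)⁻¹ ^ p.1 / (8 * (Λ + 1))) p.2 w)) at hz
      rw [hempty] at hz
      exact hz
  · -- (iv) separation
    intro p l l' hll'
    dsimp only
    by_cases halive : ∃ z, tele (fun j => pairCut n j z) p.1 * gridBump φ n ((2 : ℝ)⁻¹ ^ p.1 / (8 * (Λ + 1))) p.2 z ≠ 0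
    · rw [if_pos halive]
      exact exists_coord_sep_of_alive hΛ hφs halive hll'
    · rw [if_neg halive]
      exact exists_coord_sep_dummy n hΛ0.le (mul_pos two_pos (mesh_pos hΛ p.1)).le hll'
  · -- (v) derivative bounds
    intro p m hm z
    dsimp only
    exact hMv p.1 p.2 m hm z
  · -- (vi) summability over levels × cubes
    refine (summable_prod_of_nonneg fun p => hM0 p.1 p.2).2 ⟨fun k => hMs k, ?_⟩
    exact Summable.of_nonneg_of_le (fun k => tsum_nonneg (hM0 k)) (fun k => hMle k) hgeo
  · -- (vi) total mass `Σ_k B 2^{-k} S = 2BS`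
    have hprod : Summable (fun p : ℕ × (Fin n × Fin 4 → ℤ) => M p.1 p.2) := by
      refine (summable_prod_of_nonneg fun p => hM0 p.1 p.2).2 ⟨fun k => hMs k, ?_⟩
      exact Summable.of_nonneg_of_le (fun k => tsum_nonneg (hM0 k)) (fun k => hMle k) hgeo
    have hlev : Summable (fun k : ℕ => ∑' c, M k c) :=
      Summable.of_nonneg_of_le (fun k => tsum_nonneg (hM0 k)) (fun k => hMle k) hgeo
    rw [hprod.tsum_prod' (fun k => hMs k)]
    calc ∑' k, ∑' c, M k c ≤ ∑' k, B * (2 : ℝ)⁻¹ ^ k * S := Summable.tsum_le_tsum hMle hlev hgeo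
      _ = B * (∑' k : ℕ, (2 : ℝ)⁻¹ ^ k) * S := by rw [tsum_mul_right, tsum_mul_left]
      _ = 2 * B * S := by rw [tsum_geometric_inv_two]; ring
  · -- (vi-w) weighted summability over levels × cubes
    change Summable (fun p : ℕ × (Fin n × Fin 4 → ℤ) => M p.1 p.2 / (2 * ((2 : ℝ)⁻¹ ^ p.1 / (8 * (Λ + 1)))) ^ (K₀ * n))
    refine (summable_prod_of_nonneg fun p => hM0' p.1 p.2).2 ⟨fun k => hMs' k, ?_⟩
    exact Summable.of_nonneg_of_le (fun k => tsum_nonneg (hM0' k)) (fun k => hMle' k) hgeo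
  · -- (vi-w) weighted total mass `Σ_k B 2^{-k} S = 2BS`
    change ∑' p : ℕ × (Fin n × Fin 4 → ℤ), M p.1 p.2 / (2 * ((2 : ℝ)⁻¹ ^ p.1 / (8 * (Λ + 1)))) ^ (K₀ * n) ≤ 2 * B * S
    have hprod : Summable (fun p : ℕ × (Fin n × Fin 4 → ℤ) => M p.1 p.2 / (2 * ((2 : ℝ)⁻¹ ^ p.1 / (8 * (Λ + 1)))) ^ (K₀ * n)) := by
      refine (summable_prod_of_nonneg fun p => hM0' p.1 p.2).2 ⟨fun k => hMs' k, ?_⟩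
      exact Summable.of_nonneg_of_le (fun k => tsum_nonneg (hM0' k)) (fun k => hMle' k) hgeo
    have hlev : Summable (fun k : ℕ => ∑' c, M k c / (2 * ((2 : ℝ)⁻¹ ^ k / (8 * (Λ + 1)))) ^ (K₀ * n)) :=
      Summable.of_nonneg_of_le (fun k => tsum_nonneg (hM0' k)) (fun k => hMle' k) hgeo
    rw [hprod.tsum_prod' (fun k => hMs' k)]
    calc ∑' k, ∑' c, M k c / (2 * ((2 : ℝ)⁻¹ ^ k / (8 * (Λ + 1)))) ^ (K₀ * n) ≤ ∑' k, B * (2 : ℝ)⁻¹ ^ k * S :=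
          Summable.tsum_le_tsum hMle' hlev hgeo
      _ = B * (∑' k : ℕ, (2 : ℝ)⁻¹ ^ k) * S := by rw [tsum_mul_right, tsum_mul_left]
      _ = 2 * B * S := by rw [tsum_geometric_inv_two]; ring
  · -- (vii) pointwise sum
    intro z
    exact ((Complex.hasSum_ofReal.2 (hasSum_pieces hφs hφ1 (fun k => (2 : ℝ)⁻¹ ^ k / (8 * (Λ + 1))) G z (hGloc z))).mul_left
      κ₀).congr_fun fun p => rfl

end Summit.QuantumFields.YangMills.Cruxes.HypercubicOSDataFromInfiniteVolume.WeightedWhitney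

namespace Summit.QuantumFields.YangMills.Cruxes.HypercubicOSDataFromInfiniteVolume.TemperedCurrencies

open Summit.QuantumFields.YangMills.Cruxes.HypercubicOSDataFromInfiniteVolume.WeightedWhitney (colour_package_weighted)

/-- **`WhitneyPkgW` from the Gevrey data.**  Given a smooth `ℤ`-periodic partition of unity `φ` supported in `[-1,1]` with Gevrey derivative bounds
and a Gevrey bound for the tree's step `PairCutoff.stepψ`, the WEIGHTED off-diagonal Whitney package holds (Schwartz index `N' + 6 + K₀`). [folklore] -/
theorem whitneyPkgW_of_gevrey
    (hprof : ∃ φ : ℝ → ℝ, ContDiff ℝ ∞ φ ∧ tsupport φ ⊆ Icc (-1 : ℝ) 1 ∧ (∀ t, 0 ≤ φ t) ∧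
      (∀ t, ∑' c : ℤ, φ (t - c) = 1) ∧ ∃ (s : ℕ) (C₀ C₁ : ℝ), 1 ≤ C₀ ∧ 1 ≤ C₁ ∧
        ∀ (j : ℕ) (t : ℝ), ‖iteratedFDeriv ℝ j φ t‖ ≤ C₀ * C₁ ^ j * ((Nat.factorial j : ℕ) : ℝ) ^ s)
    (hstep : ∃ (s : ℕ) (C₀' C₁' : ℝ), 1 ≤ C₀' ∧ 1 ≤ C₁' ∧
      ∀ (i : ℕ) (t : ℝ), ‖iteratedFDeriv ℝ i stepψ t‖ ≤ C₀' * C₁' ^ i * ((Nat.factorial i : ℕ) : ℝ) ^ s) :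
    WhitneyPkgW := by
  intro Λ N' K₀ hΛ
  obtain ⟨φ, hφ, hφs, hφ0, hφ1, s₁, C₀, C₁, hC₀, hC₁, hDφ'⟩ := hprof
  obtain ⟨s₂, C₀', C₁', hC₀', hC₁', hDψ'⟩ := hstep
  -- common Gevrey exponent
  have hfac1 : ∀ j : ℕ, (1 : ℝ) ≤ ((Nat.factorial j : ℕ) : ℝ) := fun j => by
    exact_mod_cast Nat.one_le_iff_ne_zero.2 (Nat.factorial_ne_zero j)
  have hDφ : ∀ (j : ℕ) (t : ℝ), ‖iteratedFDeriv ℝ j φ t‖ ≤ C₀ * C₁ ^ j * ((Nat.factorial j : ℕ) : ℝ) ^ max s₁ s₂ :=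
    fun j t => (hDφ' j t).trans (mul_le_mul_of_nonneg_left (pow_le_pow_right₀ (hfac1 j) (le_max_left _ _))
      (by have : (0 : ℝ) ≤ C₀ := by linarith
          have : (0 : ℝ) ≤ C₁ := by linarith
          positivity))
  have hDψ : ∀ (i : ℕ) (t : ℝ), ‖iteratedFDeriv ℝ i stepψ t‖ ≤ C₀' * C₁' ^ i * ((Nat.factorial i : ℕ) : ℝ) ^ max s₁ s₂ :=
    fun i t => (hDψ' i t).trans (mul_le_mul_of_nonneg_left (pow_le_pow_right₀ (hfac1 i) (le_max_right _ _))
      (by have : (0 : ℝ) ≤ C₀' := by linarith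
          have : (0 : ℝ) ≤ C₁' := by linarith
          positivity))
  obtain ⟨α, C, γ, hα, hC, hW⟩ := level_weights_weighted hΛ N' K₀ (max s₁ s₂) hφ hφs hφ0 hφ1 hC₀ hC₁ hC₀' hC₁' hDφ hDψ
  refine ⟨N' + 6 + K₀, 4 * α, C, (γ : ℝ), by positivity, hC, Nat.cast_nonneg γ, fun n hn F hF => ?_⟩
  -- the two colours
  have hFsm : ContDiff ℝ ∞ (F : (Fin n → EuclideanSpace ℝ (Fin 4)) → ℂ) := F.smooth ⊤
  have hloc : ∀ z : Fin n → EuclideanSpace ℝ (Fin 4), (∃ l l' : Fin n, l ≠ l' ∧ z l = z l') → F z = 0 :=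
    fun z hz => hF.apply_eq_zero hz
  choose M₀ hM₀0 hM₀s hM₀le hM₀le' hM₀v using hW n hn F hF (fun w => (F w).re) (contDiff_re_comp hFsm)
    (norm_iteratedFDeriv_re_comp_le hFsm)
  choose M₁ hM₁0 hM₁s hM₁le hM₁le' hM₁v using hW n hn F hF (fun w => (F w).im) (contDiff_im_comp hFsm)
    (norm_iteratedFDeriv_im_comp_le hFsm)
  obtain ⟨Gp₀, cp₀, ρ₀, Mw₀, h2₀, h3₀, h4₀, h5₀, h60₀, h6s₀, h6t₀, h6ws₀, h6wt₀, h7₀⟩ :=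
    colour_package_weighted hΛ N' K₀ hφ hφs hφ1 (contDiff_re_comp hFsm) (fun z hz => by rw [hloc z hz, Complex.zero_re]) (1 : ℂ)
      M₀ hM₀0 hM₀s hM₀le hM₀le' hM₀v
  obtain ⟨Gp₁, cp₁, ρ₁, Mw₁, h2₁, h3₁, h4₁, h5₁, h60₁, h6s₁, h6t₁, h6ws₁, h6wt₁, h7₁⟩ :=
    colour_package_weighted hΛ N' K₀ hφ hφs hφ1 (contDiff_im_comp hFsm) (fun z hz => by rw [hloc z hz, Complex.zero_im]) Complex.I
      M₁ hM₁0 hM₁s hM₁le hM₁le' hM₁v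
  -- glue the colours over `(ℕ × cubes) ⊕ (ℕ × cubes)` and enumerate by `ℕ`
  obtain ⟨e⟩ : Nonempty (ℕ ≃ ((ℕ × (Fin n × Fin 4 → ℤ)) ⊕ (ℕ × (Fin n × Fin 4 → ℤ)))) := nonempty_equiv_of_countable
  have H1 : ∀ x : (ℕ × (Fin n × Fin 4 → ℤ)) ⊕ (ℕ × (Fin n × Fin 4 → ℤ)),
      ‖Sum.elim (fun _ => (1 : ℂ)) (fun _ => Complex.I) x‖ ≤ 1 := by
    rintro (p | p) <;> simp
  have H2 : ∀ x : (ℕ × (Fin n × Fin 4 → ℤ)) ⊕ (ℕ × (Fin n × Fin 4 → ℤ)), 0 < Sum.elim ρ₀ ρ₁ x ∧ Sum.elim ρ₀ ρ₁ x ≤ 1 / 2 := by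
    rintro (p | p)
    exacts [h2₀ p, h2₁ p]
  have H3 : ∀ x : (ℕ × (Fin n × Fin 4 → ℤ)) ⊕ (ℕ × (Fin n × Fin 4 → ℤ)),
      tsupport ((Sum.elim Gp₀ Gp₁ x : SchwartzMap (Fin n → EuclideanSpace ℝ (Fin 4)) ℝ) :
        (Fin n → EuclideanSpace ℝ (Fin 4)) → ℝ) ⊆ {z | ∀ l, ‖z l - Sum.elim cp₀ cp₁ x l‖ ≤ Sum.elim ρ₀ ρ₁ x} := by
    rintro (p | p)
    exacts [h3₀ p, h3₁ p]
  have H4 : ∀ (x : (ℕ × (Fin n × Fin 4 → ℤ)) ⊕ (ℕ × (Fin n × Fin 4 → ℤ))) (l l' : Fin n), l ≠ l' →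
      ∃ i : Fin 4, Λ * Sum.elim ρ₀ ρ₁ x ≤ |Sum.elim cp₀ cp₁ x l i - Sum.elim cp₀ cp₁ x l' i| := by
    rintro (p | p) l l' hll'
    exacts [h4₀ p l l' hll', h4₁ p l l' hll']
  have H5 : ∀ (x : (ℕ × (Fin n × Fin 4 → ℤ)) ⊕ (ℕ × (Fin n × Fin 4 → ℤ))) (m : ℕ), m ≤ N' * n →
      ∀ z, ‖iteratedFDeriv ℝ m ((Sum.elim Gp₀ Gp₁ x : SchwartzMap (Fin n → EuclideanSpace ℝ (Fin 4)) ℝ) :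
        (Fin n → EuclideanSpace ℝ (Fin 4)) → ℝ) z‖ ≤ Sum.elim Mw₀ Mw₁ x / Sum.elim ρ₀ ρ₁ x ^ m := by
    rintro (p | p) m hm z
    exacts [h5₀ p m hm z, h5₁ p m hm z]
  have H6 : ∀ x : (ℕ × (Fin n × Fin 4 → ℤ)) ⊕ (ℕ × (Fin n × Fin 4 → ℤ)), 0 ≤ Sum.elim Mw₀ Mw₁ x := by
    rintro (p | p)
    exacts [h60₀ p, h60₁ p]
  have HW : ∀ x : (ℕ × (Fin n × Fin 4 → ℤ)) ⊕ (ℕ × (Fin n × Fin 4 → ℤ)),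
      Sum.elim Mw₀ Mw₁ x / Sum.elim ρ₀ ρ₁ x ^ (K₀ * n) =
        Sum.elim (fun p => Mw₀ p / ρ₀ p ^ (K₀ * n)) (fun p => Mw₁ p / ρ₁ p ^ (K₀ * n)) x := by
    rintro (p | p) <;> rfl
  refine ⟨fun j => Sum.elim (fun _ => (1 : ℂ)) (fun _ => Complex.I) (e j), fun j => Sum.elim Gp₀ Gp₁ (e j),
    fun j => Sum.elim cp₀ cp₁ (e j), fun j => Sum.elim ρ₀ ρ₁ (e j), fun j => Sum.elim Mw₀ Mw₁ (e j),
    fun j => H1 (e j), fun j => H2 (e j), fun j => H3 (e j), fun j l l' hll' => H4 (e j) l l' hll',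
    fun j m hm z => H5 (e j) m hm z, fun j => H6 (e j), ?_, ?_, ?_, ?_, ?_⟩
  · exact (e.summable_iff (f := Sum.elim Mw₀ Mw₁)).2 (Summable.sum _ (by exact h6s₀) (by exact h6s₁))
  · rw [Equiv.tsum_eq e (Sum.elim Mw₀ Mw₁), Summable.tsum_sum (by exact h6s₀) (by exact h6s₁), Real.rpow_natCast]
    simp only [Sum.elim_inl, Sum.elim_inr]
    have : ∑' p, Mw₀ p + ∑' p, Mw₁ p ≤ 2 * (α * C ^ n * (n.factorial : ℝ) ^ γ) * schwartzNorm ((N' + 6 + K₀) * n) F +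
        2 * (α * C ^ n * (n.factorial : ℝ) ^ γ) * schwartzNorm ((N' + 6 + K₀) * n) F := add_le_add h6t₀ h6t₁
    linarith
  · have hsum : Summable (Sum.elim (fun p => Mw₀ p / ρ₀ p ^ (K₀ * n)) (fun p => Mw₁ p / ρ₁ p ^ (K₀ * n))) :=
      Summable.sum _ (by exact h6ws₀) (by exact h6ws₁)
    have := (e.summable_iff (f := Sum.elim (fun p => Mw₀ p / ρ₀ p ^ (K₀ * n)) (fun p => Mw₁ p / ρ₁ p ^ (K₀ * n)))).2 hsum
    refine this.congr fun j => ?_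
    exact (HW (e j)).symm
  · have hfun : (fun j => Sum.elim Mw₀ Mw₁ (e j) / Sum.elim ρ₀ ρ₁ (e j) ^ (K₀ * n)) =
        fun j => Sum.elim (fun p => Mw₀ p / ρ₀ p ^ (K₀ * n)) (fun p => Mw₁ p / ρ₁ p ^ (K₀ * n)) (e j) := by
      funext j; exact HW (e j)
    rw [hfun, Equiv.tsum_eq e (Sum.elim (fun p => Mw₀ p / ρ₀ p ^ (K₀ * n)) (fun p => Mw₁ p / ρ₁ p ^ (K₀ * n))),
      Summable.tsum_sum (by exact h6ws₀) (by exact h6ws₁), Real.rpow_natCast]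
    simp only [Sum.elim_inl, Sum.elim_inr]
    have : ∑' p, Mw₀ p / ρ₀ p ^ (K₀ * n) + ∑' p, Mw₁ p / ρ₁ p ^ (K₀ * n) ≤
        2 * (α * C ^ n * (n.factorial : ℝ) ^ γ) * schwartzNorm ((N' + 6 + K₀) * n) F +
        2 * (α * C ^ n * (n.factorial : ℝ) ^ γ) * schwartzNorm ((N' + 6 + K₀) * n) F := add_le_add h6wt₀ h6wt₁
    linarith
  · intro z
    refine (Equiv.hasSum_iff e (f := fun x => Sum.elim (fun _ => (1 : ℂ)) (fun _ => Complex.I) x *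
      ((Sum.elim Gp₀ Gp₁ x z : ℝ) : ℂ))).2 ?_
    have h := HasSum.sum (f := fun x => Sum.elim (fun _ => (1 : ℂ)) (fun _ => Complex.I) x *
      ((Sum.elim Gp₀ Gp₁ x z : ℝ) : ℂ)) (by exact h7₀ z) (by exact h7₁ z)
    rwa [re_add_I_mul_im] at h

/-- **W `stub_weightedWhitneyPkg`** — the WEIGHTED off-diagonal Whitney package (registered stub of the g19 lines «TemperedPeak» /
«OctaveDoubling» on stmt-QuantumFields-19868, by name and signature): `whitneyPkgW_of_gevrey` applied to the Gevrey profile of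
`GevreyMollifier.exists_gevrey_periodic_partition` and the Gevrey bound `WhitneyAssembly.stepψ_gevrey` for the tree's step. [folklore] -/
theorem stub_weightedWhitneyPkg : WhitneyPkgW :=
  whitneyPkgW_of_gevrey
    (by
      obtain ⟨φ, h1, h2, h3, -, h5, C₀, C₁, hC₀, hC₁, h6⟩ := GevreyMollifier.exists_gevrey_periodic_partition
      exact ⟨φ, h1, h2, h3, h5, 2, C₀, C₁, hC₀, hC₁, h6⟩)
    (by
      obtain ⟨C₀', C₁', h1, h2, h3⟩ := stepψ_gevrey
      exact ⟨2, C₀', C₁', h1, h2, h3⟩)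

end Summit.QuantumFields.YangMills.Cruxes.HypercubicOSDataFromInfiniteVolume.TemperedCurrencies

end
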